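import Summits.AnomalousDissipation.AnomalousDissipation.Theorems.SolenoidalFractalHomogenisationPermissibleFractalCarrierSeries
import Literature.Analysis.FluidPDE.LagrangianLatticeCarrier
import HarnessLib

/-!
# K3L `LagrangianCarrierConstruction` (stmt-AnomalousDissipation-24913), line `birth`, stub `stub_regularL`: REDUCTION of `Regular` to one
# quantitative per-level estimate (helper; `--supports stmt-AnomalousDissipation-24913`)

Summits-side helper file (everything proved; no definitions, no named facts). Third brick towards `stub_regularL` (skeleton r23 v6): the
conclusion `E.Regular` — `LevelRegular` (pointwise summability (R0) + the eleven qualitative clauses), the summed carrier continuous in time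
with values in some `C^{0,r}`, time periodic, weakly divergence free at every time — FOLLOWS from the eleven qualitative clauses, a common
time period of the level fields, and ONE quantitative input: a summable sequence `ρ` dominating the `C^{0,r}` norms of the level fields,
`‖b (m+1) t‖_{C^{0,r}} ≤ ρ m`, together with continuity of each level in the `C^{0,r}` norm (`regular_of_levelBounds`; Tannery's theorem in
`C^{0,r}` = `…PermissibleFractalCarrierSeries.continuousInHolderOn_tsum`, and the exchange `∫ Σ = Σ ∫` against test gradients). This isolates
the crux-sized part of `stub_regularL`: the distortion estimate of Armstrong–Vicol §5.1 that produces `ρ m ≍ (a_{m+1}/N_{m+1})^{1−r} a_{m+1}^r`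
from `IsLagrangian`, the strain clause (S), `N_m² ≤ N_{m+1}`, (T4) and the amplitude decay. Infrastructure for route-1's rung leaf F-D1.A0 (a
frontier FORMAL rung); NOT a proof of anomalous dissipation.
-/

set_option linter.dupNamespace false

noncomputable section

namespace Summit.AnomalousDissipation.AnomalousDissipation.Theorems.SolenoidalFractalHomogenisation.LagrangianCarrierConstruction

open Set Function Filter Topology MeasureTheory
open scoped NNReal ENNReal InnerProductSpace
open Literature.Analysis Literature.Analysis.FunctionSpaces Literature.Analysis.FunctionSpaces.Torus
open Literature.Analysis.FluidPDE Literature.Analysis.FluidPDE.LatticeShear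
open Summit.AnomalousDissipation.AnomalousDissipation.Theorems.SolenoidalFractalHomogenisation.PermissibleCarrier (continuousInHolderOn_tsum)

variable {k : ℕ}

/-- **`Regular` from per-level `C^{0,r}` bounds.** See the module docstring. [cite: ArmstrongVicol2025, §2.2 (PDF p. 18: |ψ_{m,k}| ≤ ε_m^β summable,
L^∞ convergence of the level series) and Thm. 1.1 (regularity class of the carrier)] -/
theorem regular_of_levelBounds (E : LagrangianLatticeCarrier k)
    (h1 : ∀ m, Continuous (Function.uncurry (E.b (m + 1))))
    (h2 : ∀ m t, Torus.IsWeaklyDivFree (E.b (m + 1) t))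
    (h3a : ∀ m t, Torus.IsSmooth (E.b (m + 1) t))
    (h3b : ∀ m (n : ℕ), ∃ C : ℝ, ∀ t y, ‖iteratedFDeriv ℝ n (Torus.lift (E.b (m + 1) t)) y‖ ≤ C)
    (h4 : ∀ m, ∃ τ : ℝ, 0 < τ ∧ Function.Periodic (E.b (m + 1)) τ)
    (hF1a : ∀ m s, Continuous fun p : ℝ × UnitAddTorus (Fin 3) => E.disp m p.1 s p.2)
    (hF1b : ∀ m t s, Torus.IsSmooth (E.disp m t s))
    (hF1c : ∀ m (n : ℕ) (j : ℤ), ∃ C : ℝ, ∀ t ∈ E.window (m + 1) j, ∀ y,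
      ‖iteratedFDeriv ℝ n (Torus.lift (E.disp m t ((j : ℝ) * E.refresh (m + 1)))) y‖ ≤ C)
    (hF2a : ∀ m s, E.X m s s = id) (hF2b : ∀ m t s r, E.X m t s ∘ E.X m s r = E.X m t r)
    (hF2c : ∀ m t s, MeasurePreserving (E.X m t s) volume volume)
    {T : ℝ} (hT : 0 < T) (hper : ∀ m, Function.Periodic (E.b (m + 1)) T)
    {r : ℝ≥0} (hr : 0 < r) {ρ : ℕ → ℝ} (hρ0 : ∀ m, 0 ≤ ρ m) (hρ : Summable ρ)
    (hsup : ∀ m t x, ‖E.b (m + 1) t x‖ ≤ ρ m)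
    (hhol : ∀ m t, eBoundedHolderNorm r (E.b (m + 1) t) ≤ ENNReal.ofReal (ρ m))
    (hcont : ∀ m t₀, Tendsto (fun t => eBoundedHolderNorm r (E.b (m + 1) t - E.b (m + 1) t₀)) (𝓝 t₀) (𝓝 0)) :
    E.Regular := by
  -- (R0) pointwise summability
  have hR0 : ∀ t x, Summable fun m => E.b (m + 1) t x := fun t x =>
    Summable.of_norm_bounded (g := ρ) hρ fun m => hsup m t x
  refine ⟨⟨hR0, h1, h2, h3a, h3b, h4, hF1a, hF1b, hF1c, hF2a, hF2b, hF2c⟩, r, hr, ?_, ⟨T, hT, fun t => ?_⟩, fun t => ?_⟩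
  · -- continuity in time with values in `C^{0,r}` (Tannery)
    exact continuousInHolderOn_tsum (S := univ) (r := r) (fun m => E.b (m + 1)) hρ0 hρ (fun t _ x => hR0 t x)
      (fun m t _ => hhol m t) fun m t₀ _ => (hcont m t₀).mono_left nhdsWithin_le_nhds
  · -- time periodicity with the common period `T`
    funext x
    show (∑' m, E.b (m + 1) (t + T) x) = ∑' m, E.b (m + 1) t x
    exact tsum_congr fun m => by rw [hper m t]
  · -- weak divergence-freeness of the sum: exchange `∫` and `Σ`
    intro θ hθ
    have hgc : Continuous (Torus.gradient θ) := hθ.gradient.continuous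
    obtain ⟨M, hM⟩ := isCompact_univ.exists_bound_of_continuousOn hgc.continuousOn
    have hM0 : 0 ≤ M := (norm_nonneg _).trans (hM 0 (mem_univ _))
    have hpt : ∀ x, ⟪E.carrier t x, Torus.gradient θ x⟫_ℝ = ∑' m, ⟪E.b (m + 1) t x, Torus.gradient θ x⟫_ℝ := by
      intro x
      rw [LagrangianLatticeCarrier.carrier, real_inner_comm, ← innerSL_apply_apply ℝ, ContinuousLinearMap.map_tsum _ (hR0 t x)]
      exact tsum_congr fun m => by rw [innerSL_apply_apply, real_inner_comm]
    simp_rw [hpt]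
    have hbc : ∀ m, Continuous (E.b (m + 1) t) := fun m => (h1 m).comp (continuous_const.prodMk continuous_id)
    have hmeas : ∀ m, AEStronglyMeasurable (fun x => ⟪E.b (m + 1) t x, Torus.gradient θ x⟫_ℝ) volume := fun m =>
      ((hbc m).inner hgc).aestronglyMeasurable
    have hbound : ∀ m x, ‖⟪E.b (m + 1) t x, Torus.gradient θ x⟫_ℝ‖ₑ ≤ ENNReal.ofReal (ρ m * M) := by
      intro m x
      rw [← ofReal_norm]
      refine ENNReal.ofReal_le_ofReal ?_
      calc ‖⟪E.b (m + 1) t x, Torus.gradient θ x⟫_ℝ‖ ≤ ‖E.b (m + 1) t x‖ * ‖Torus.gradient θ x‖ := norm_inner_le_norm _ _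
        _ ≤ ρ m * M := mul_le_mul (hsup m t x) (hM x (mem_univ x)) (norm_nonneg _) (hρ0 m)
    have hfin : ∑' m, ∫⁻ x, ‖⟪E.b (m + 1) t x, Torus.gradient θ x⟫_ℝ‖ₑ ≠ ∞ := by
      refine ne_top_of_le_ne_top (b := ∑' m, ENNReal.ofReal (ρ m * M)) ?_ ?_
      · rw [← ENNReal.ofReal_tsum_of_nonneg (fun m => mul_nonneg (hρ0 m) hM0) (hρ.mul_right _)]
        exact ENNReal.ofReal_ne_top
      · refine ENNReal.tsum_le_tsum fun m => ?_
        calc ∫⁻ x, ‖⟪E.b (m + 1) t x, Torus.gradient θ x⟫_ℝ‖ₑ ≤ ∫⁻ _ : UnitAddTorus (Fin 3), ENNReal.ofReal (ρ m * M) :=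
              lintegral_mono fun x => hbound m x
          _ = _ := by rw [lintegral_const, measure_univ, mul_one]
    rw [integral_tsum hmeas hfin]
    simp_rw [h2 _ t θ hθ, tsum_zero]

end Summit.AnomalousDissipation.AnomalousDissipation.Theorems.SolenoidalFractalHomogenisation.LagrangianCarrierConstruction

end
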